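import Summits.ResolutionOfSingularities.ResolutionOfSingularities.Theorems.WeightedInvariantELadderTwoCentreAssembly
import Summits.ResolutionOfSingularities.ResolutionOfSingularities.Theorems.WeightedInvariantE2CentreSchemeGlue
import Summits.ResolutionOfSingularities.ResolutionOfSingularities.Theorems.WeightedInvariantE2HomogeneousChart
import HarnessLib

/-!
# W4.3 door (stmt-ResolutionOfSingularities-19897), E2 CENTRE: `stub_e2_centre_h` FROM THE ONE REMAINING WORD (G-6b)
# `PRungGrHomLE 3 p ι J → E2HomogeneousChartBody p ι J → E2CentreHomBody p ι J`

[OURS · L1 W4.3 · registrar glue] Route `ResolutionOfSingularities/WeightedInvariant`, door crux `HypersurfaceCentreConstruction`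
(stmt-ResolutionOfSingularities-19897), E2 centre `stub_e2_centre_h` (SPEC (Δ11b) rev 10).  Pure composition of LANDED theorems, written by the
registrar res-L1-w43-plan-1 (v3.13 glue term, probe `glue_v313_probe.lean` rc 0; STATUS 2026-08-27T22:25:19Z (F-5)) and landed VERBATIM by
res-L1-type-o4 (`--supports stmt-ResolutionOfSingularities-19897 --as helper`):
`stub_e2_centre_h_of_glue` (…ELadderTwoCentreAssembly) ∘ `e2CentreSchemeGlue` ((o47-c-scheme), res-D-pv-048, …E2CentreSchemeGlue) ∘
`e2HomogeneousChart` ((G-0), …E2HomogeneousChart).  After this file the E2 centre rests on EXACTLY ONE hypothesis, (G-6b)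
`hhom : PRungGrHomLE 3 p ι J → E2HomogeneousChartBody p ι J → E2CentreHomBody p ι J` (RE-ENTRY OBJECT #2 of CHAIN w43 v4.39; no live hand).
Nothing here is a statement of H. Hironaka's 2017 manuscript (under adjudication; nothing of it asserted or used); candidates stay candidates;
AI-written, weaker than expert review.  No definition; no new axiom.
-/

set_option linter.dupNamespace false -- mandated namespace of this single-conjunct summit

namespace Summit.ResolutionOfSingularities.ResolutionOfSingularities.Cruxes.HypersurfaceCentreConstruction.LocalEngine

/-- **`E2CentreH p ι J` from the word (G-6b) at one prime `p`**: the scheme glue `e2CentreSchemeGlue` fed with the homogeneous charts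
`e2HomogeneousChart` and the (hom) word, then `e2CentreH_of_glue`. [OURS · registrar glue v3.13] -/
theorem e2CentreH_of_hom (p : ℕ) (hp : p.Prime) (ι : (R : Type) → [CommRing R] → R → Ordinal.{0})
    (J : (R : Type) → [CommRing R] → R → ℕ → Ideal R)
    (hhom : PRungGrHomLE 3 p ι J → E2HomogeneousChartBody p ι J → E2CentreHomBody p ι J) :
    E2CentreH p ι J :=
  e2CentreH_of_glue p ι J fun hr =>
    e2CentreSchemeGlue p ι J hr (e2HomogeneousChart p hp ι J hr) (hhom hr (e2HomogeneousChart p hp ι J hr))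

/-- **`stub_e2_centre_h` BY ITS STATEMENT from the single word (G-6b)** `∀ p prime, ∀ ι J, PRungGrHomLE 3 p ι J →
E2HomogeneousChartBody p ι J → E2CentreHomBody p ι J` (registrar quantifier shape; the v3.13 closing term of res-L1-w43-plan-1, verbatim).
[OURS · registrar glue v3.13] -/
theorem stub_e2_centre_h_of_hom
    (hhom : ∀ p : ℕ, p.Prime → ∀ (ι : (R : Type) → [CommRing R] → R → Ordinal.{0})
      (J : (R : Type) → [CommRing R] → R → ℕ → Ideal R),
      PRungGrHomLE 3 p ι J → E2HomogeneousChartBody p ι J → E2CentreHomBody p ι J) :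
    ∀ p : ℕ, p.Prime → ∀ (ι : (R : Type) → [CommRing R] → R → Ordinal.{0})
      (J : (R : Type) → [CommRing R] → R → ℕ → Ideal R), E2CentreH p ι J :=
  stub_e2_centre_h_of_glue fun p hp ι J hr =>
    e2CentreSchemeGlue p ι J hr (e2HomogeneousChart p hp ι J hr) (hhom p hp ι J hr (e2HomogeneousChart p hp ι J hr))

end Summit.ResolutionOfSingularities.ResolutionOfSingularities.Cruxes.HypersurfaceCentreConstruction.LocalEngine
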